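import Mathlib

/-!
# The norm-fibre sum of a quadratic extension of finite fields is minus the Kloosterman sum

Topic `NumberTheory/GaussSums`.  Let `l/k` be a quadratic extension of **finite** fields
(`Module.finrank k l = 2`, `q = #k`), `ψ` a nontrivial additive character of `k` and `a ∈ kˣ`.
Then (`sum_normFibre_addChar_trace_eq_neg_kloosterman`)

  `∑_{z ∈ l, N_{l/k}(z) = a} ψ(Tr_{l/k} z) = - ∑_{x ∈ kˣ} ψ(x + a x⁻¹)`:

the character sum over a fibre of the norm is minus the Kloosterman sum `Kl(ψ; 1, a)`.  This is
the residue-field identity behind the matching of the unit elements of the Hecke algebras (the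
"fundamental lemma for the unit") in the relative-trace-formula proof of quadratic base change for
`GL(2)` — Y. Ye, *Kloosterman integrals and base change for GL(2)*, J. reine angew. Math. 400
(1989), 57–121.  As an identity of exponential sums over a finite field it is folklore: summed
against the multiplicative characters of `kˣ` it is the quadratic case
`g_l(χ ∘ N, ψ ∘ Tr) = -g_k(χ, ψ)²` of the Davenport–Hasse lifting theorem.  The proof below uses
no Gauss sums at all, only a point count.

## The elementary proof

Group both sums according to the value `t` of the "trace": the left sum is
`∑_t #{z ∈ l : Tr z = t, N z = a} · ψ(t)` (`sum_filter_norm_addChar_trace_eq_sum_card_mul`), and,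
since `x ↦ (x, a/x)` identifies `kˣ` with the pairs of product `a`, the Kloosterman sum is
`∑_t #{x ∈ k : x² - t x + a = 0} · ψ(t)` (`sum_units_addChar_add_mul_inv_eq_sum_card_mul`).  The
key count (`card_filter_trace_norm_add_card_filter_quadratic`) is, for **every** `t, n ∈ k`,

  `#{z ∈ l : Tr z = t, N z = n} + #{x ∈ k : x² - t x + n = 0} = 2`.

Indeed `Tr z = z + z^q` and `N z = z · z^q` (`z^q` is the Frobenius conjugate), so both sets
consist of roots of `f = X² - tX + n`, which splits in `l` as `(X - α)(X - β)` because `l` is *the*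
quadratic extension of `k` (`exists_add_eq_mul_eq_of_finrank_eq_two`).  If `α ∉ k` then
`β = α^q ≠ α`, the fibre is `{α, β}` and `f` has no root in `k`: `2 + 0`.  If `α ∈ k` then
`β = t - α ∈ k` and a `z` in the fibre lies in `{α, β} ⊆ k`, where `Tr z = 2z`, `N z = z²`; so for
`α ≠ β` the fibre is empty: `0 + 2`, and for `α = β` it is `{α}`: `1 + 1`.  Hence
`LHS + Kl = 2 ∑_{t ∈ k} ψ(t) = 0` (`sum_normFibre_addChar_trace_add_kloosterman` and Mathlib's
`AddChar.sum_eq_zero_of_ne_one`).  With `ψ = 1` the same count gives the classical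
`#{z ∈ l : N z = a} = q + 1` (`card_filter_norm_eq_card_add_one`).

Everything is proved; there are no definitions and no named facts.  The Kloosterman sum is written
out as `∑ x : kˣ, ψ (x + a * x⁻¹)` (unit inverse) for a general finite field `k` and a general
`ψ : AddChar k ℂ`; the tree's `Literature.NumberTheory.LFunctions.kloostermanSum` is the special
case `k = ZMod q`, `ψ = ZMod.stdAddChar` and is not used here.

## What is NOT here

Kloosterman / orbital integrals over `p`-adic fields (Ye's fundamental lemma proper and its
transfer between characteristics), the Davenport–Hasse relation, Weil's bound.

## References

* Y. Ye, *Kloosterman integrals and base change for GL(2)*, J. reine angew. Math. 400 (1989),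
  57–121.
* H. Jacquet, Y. Ye, *Une remarque sur le changement de base quadratique*, C. R. Acad. Sci.
  Paris Sér. I 311 (1990), 671–676.
* R. Lidl, H. Niederreiter, *Finite Fields*, 2nd ed., Cambridge UP 1997, Ch. 5 (Gauss sums, the
  Davenport–Hasse theorem, Kloosterman sums).
-/

namespace Literature.NumberTheory.GaussSums

open Finset Polynomial

variable {k l : Type*} [Field k] [Fintype k] [Field l] [Fintype l] [Algebra k l]

/-! ### Trace, norm and Frobenius in a quadratic extension of finite fields -/

/-- In a quadratic extension `l/k` of finite fields, `Tr_{l/k}(z) = z + z^q` (`q = #k`), i.e. the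
trace is the sum of `z` and its Frobenius conjugate. [folklore] -/
theorem algebraMap_trace_eq_add_pow_card_of_finrank_eq_two (h2 : Module.finrank k l = 2)
    (z : l) : algebraMap k l (Algebra.trace k l z) = z + z ^ Fintype.card k := by
  rw [FiniteField.algebraMap_trace_eq_sum_pow, h2, Finset.sum_range_succ, Finset.sum_range_one,
    pow_zero, pow_one, pow_one, Nat.card_eq_fintype_card]

/-- In a quadratic extension `l/k` of finite fields, `N_{l/k}(z) = z · z^q` (`q = #k`), i.e. the
norm is the product of `z` and its Frobenius conjugate. [folklore] -/
theorem algebraMap_norm_eq_mul_pow_card_of_finrank_eq_two (h2 : Module.finrank k l = 2)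
    (z : l) : algebraMap k l (Algebra.norm k z) = z * z ^ Fintype.card k := by
  rw [FiniteField.algebraMap_norm_eq_prod_pow, h2, Finset.prod_range_succ, Finset.prod_range_one,
    pow_zero, pow_one, pow_one, Nat.card_eq_fintype_card]

/-- In a quadratic extension `l/k` of finite fields the `q`-Frobenius is an involution:
`(z^q)^q = z^{q²} = z^{#l} = z`. [folklore] -/
theorem pow_card_pow_card_of_finrank_eq_two (h2 : Module.finrank k l = 2) (z : l) :
    (z ^ Fintype.card k) ^ Fintype.card k = z := by
  rw [← pow_mul, ← sq, ← h2, ← Module.card_eq_pow_finrank, FiniteField.pow_card]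

variable (k) in
/-- For an extension `l/k` of finite fields, the fixed points of the `q`-Frobenius `z ↦ z^q`
(`q = #k`) on `l` are exactly the elements of `k` (the Galois group is generated by Frobenius
and `l/k` is Galois). [folklore] -/
theorem mem_range_algebraMap_iff_pow_card_eq_self (z : l) :
    z ∈ Set.range (algebraMap k l) ↔ z ^ Fintype.card k = z := by
  rw [IsGalois.mem_range_algebraMap_iff_fixed]
  refine ⟨fun h => h (FiniteField.frobeniusAlgEquivOfAlgebraic k l), fun h σ => ?_⟩
  obtain ⟨⟨n, hn⟩, rfl⟩ := (FiniteField.bijective_frobeniusAlgEquivOfAlgebraic_pow k l).2 σ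
  simp only
  clear hn
  induction n with
  | zero => simp
  | succ n ih =>
    rw [pow_succ, AlgEquiv.mul_apply, FiniteField.coe_frobeniusAlgEquivOfAlgebraic]
    simpa only [h] using ih

/-! ### Every quadratic polynomial over `k` splits in the quadratic extension `l` -/

/-- If `l/k` is a quadratic extension of finite fields, every monic quadratic `X² - tX + n ∈ k[X]`
splits in `l`: there are `α, β ∈ l` with `α + β = t` and `αβ = n`.  (If it has no root in `k` it
is irreducible, `k[X]/(X² - tX + n)` is a field of degree `2` over `k`, and any two extensions of
a finite field of the same degree admit a `k`-embedding — Mathlib's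
`FiniteField.nonempty_algHom_of_finrank_dvd`.) [folklore] -/
theorem exists_add_eq_mul_eq_of_finrank_eq_two (h2 : Module.finrank k l = 2) (t n : k) :
    ∃ α β : l, α + β = algebraMap k l t ∧ α * β = algebraMap k l n := by
  set g : k[X] := C 1 * X ^ 2 + C (-t) * X + C n with hg
  have hdeg : g.natDegree = 2 := natDegree_quadratic one_ne_zero
  have heval : ∀ x : l, aeval x g = x ^ 2 - algebraMap k l t * x + algebraMap k l n := by
    intro x
    simp only [hg, map_add, map_mul, map_pow, aeval_C, aeval_X, map_one, one_mul, map_neg]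
    ring
  -- it suffices to find a root `α` of `g = X² - t X + n` in `l`
  suffices h : ∃ α : l, aeval α g = 0 by
    obtain ⟨α, hα⟩ := h
    rw [heval] at hα
    exact ⟨α, algebraMap k l t - α, by ring, by linear_combination -hα⟩
  by_cases hk : ∃ x : k, g.IsRoot x
  · obtain ⟨x, hx⟩ := hk
    refine ⟨algebraMap k l x, ?_⟩
    rw [aeval_algebraMap_apply, coe_aeval_eq_eval, hx.eq_zero, map_zero]
  · have hirr : Irreducible g :=
      irreducible_of_degree_le_three_of_not_isRoot (by rw [hdeg]; decide) fun x hx => hk ⟨x, hx⟩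
    haveI := Fact.mk hirr
    have hfin : Module.finrank k (AdjoinRoot g) = 2 := by
      rw [(AdjoinRoot.powerBasis hirr.ne_zero).finrank, AdjoinRoot.powerBasis_dim, hdeg]
    obtain ⟨f⟩ := FiniteField.nonempty_algHom_of_finrank_dvd (F := k) (K := AdjoinRoot g) (L := l)
      (by rw [hfin, h2])
    refine ⟨f (AdjoinRoot.root g), ?_⟩
    rw [aeval_algHom_apply, AdjoinRoot.aeval_eq, AdjoinRoot.mk_self, map_zero]

/-! ### The key count: `#{z ∈ l : Tr z = t, N z = n} + #{x ∈ k : x² - tx + n = 0} = 2` -/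

/-- **The point count.**  For a quadratic extension `l/k` of finite fields and any `t, n ∈ k`,
`#{z ∈ l : Tr_{l/k} z = t ∧ N_{l/k} z = n} + #{x ∈ k : x² - t x + n = 0} = 2`.
Write `X² - tX + n = (X - α)(X - β)` in `l[X]`; both sets consist of roots.  If `α ∉ k` then
`β = α^q ≠ α` (`q = #k`), the fibre is `{α, β}` and there is no root in `k` (`2 + 0`); if
`α, β ∈ k` and `α ≠ β` the fibre is empty, since an element `z ∈ k` has `Tr z = 2z`, `N z = z²`
(`0 + 2`); if `α = β` (`∈ k`) the fibre is `{α}` (`1 + 1`). [folklore] -/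
theorem card_filter_trace_norm_add_card_filter_quadratic [DecidableEq k]
    (h2 : Module.finrank k l = 2) (t n : k) :
    (univ.filter fun z : l => Algebra.trace k l z = t ∧ Algebra.norm k z = n).card +
      (univ.filter fun x : k => x ^ 2 - t * x + n = 0).card = 2 := by
  classical
  set q := Fintype.card k
  have hinj := (algebraMap k l).injective
  obtain ⟨α, β, hs, hp⟩ := exists_add_eq_mul_eq_of_finrank_eq_two h2 t n
  -- Frobenius fixes `k` pointwise
  have hfix : ∀ x : k, algebraMap k l x ^ q = algebraMap k l x := fun x => by
    rw [← map_pow, FiniteField.pow_card]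
  -- the roots of `X² - t X + n` in `l` are `α` and `β`
  have hroot : ∀ z : l, z ^ 2 - algebraMap k l t * z + algebraMap k l n = 0 ↔ z = α ∨ z = β := by
    intro z
    have e : z ^ 2 - (α + β) * z + α * β = (z - α) * (z - β) := by ring
    rw [← hs, ← hp, e, mul_eq_zero, sub_eq_zero, sub_eq_zero]
  -- the fibre condition, read inside `l`
  have hA : ∀ z : l, (Algebra.trace k l z = t ∧ Algebra.norm k z = n) ↔
      (z + z ^ q = algebraMap k l t ∧ z * z ^ q = algebraMap k l n) := by
    intro z
    rw [← hinj.eq_iff, ← hinj.eq_iff (a := Algebra.norm k z),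
      algebraMap_trace_eq_add_pow_card_of_finrank_eq_two h2,
      algebraMap_norm_eq_mul_pow_card_of_finrank_eq_two h2]
  -- elements of the fibre are roots
  have hAroot : ∀ z : l, z + z ^ q = algebraMap k l t → z * z ^ q = algebraMap k l n →
      z = α ∨ z = β := by
    intro z h1 h1'
    rw [← hroot, ← h1, ← h1']
    ring
  -- Frobenius permutes the roots
  have hφ : ∀ z : l, (z = α ∨ z = β) → (z ^ q = α ∨ z ^ q = β) := by
    intro z hz
    rw [← hroot] at hz ⊢
    have := congr_arg (FiniteField.frobeniusAlgHom k l) hz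
    simpa only [map_add, map_sub, map_mul, map_pow, AlgHom.commutes, map_zero,
      FiniteField.coe_frobeniusAlgHom] using this
  by_cases hα : α ^ q = α
  · -- both roots lie in `k`
    obtain ⟨a₀, rfl⟩ := (mem_range_algebraMap_iff_pow_card_eq_self k α).mpr hα
    obtain ⟨b₀, rfl⟩ : ∃ b₀ : k, algebraMap k l b₀ = β :=
      ⟨t - a₀, by rw [map_sub, ← hs, add_sub_cancel_left]⟩
    rw [← map_add, hinj.eq_iff] at hs
    rw [← map_mul, hinj.eq_iff] at hp
    have hB : ∀ x : k, x ^ 2 - t * x + n = 0 ↔ x = a₀ ∨ x = b₀ := by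
      intro x
      have e : x ^ 2 - (a₀ + b₀) * x + a₀ * b₀ = (x - a₀) * (x - b₀) := by ring
      rw [← hs, ← hp, e, mul_eq_zero, sub_eq_zero, sub_eq_zero]
    have hA' : ∀ z : l, (Algebra.trace k l z = t ∧ Algebra.norm k z = n) ↔
        (z = algebraMap k l a₀ ∧ a₀ = b₀) := by
      intro z
      rw [hA]
      constructor
      · rintro ⟨h1, h1'⟩
        rcases hAroot z h1 h1' with rfl | rfl
        · rw [hfix, ← map_add, hinj.eq_iff, ← hs] at h1
          exact ⟨rfl, add_left_cancel h1⟩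
        · rw [hfix, ← map_add, hinj.eq_iff, ← hs] at h1
          have hba : b₀ = a₀ := add_right_cancel h1
          exact ⟨by rw [hba], hba.symm⟩
      · rintro ⟨rfl, rfl⟩
        rw [hfix, ← map_add, ← map_mul, hs, hp]
        exact ⟨rfl, rfl⟩
    by_cases hab : a₀ = b₀
    · -- a double root `a₀ ∈ k`: the fibre is `{a₀}`, the root set is `{a₀}`
      subst hab
      have e1 : (univ.filter fun z : l => Algebra.trace k l z = t ∧ Algebra.norm k z = n) =
          {algebraMap k l a₀} := by
        ext z
        simp [hA']
      have e2 : (univ.filter fun x : k => x ^ 2 - t * x + n = 0) = {a₀} := by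
        ext x
        simp [hB]
      rw [e1, e2, card_singleton, card_singleton]
    · -- two distinct roots in `k`: the fibre is empty
      have e1 : (univ.filter fun z : l => Algebra.trace k l z = t ∧ Algebra.norm k z = n) = ∅ := by
        ext z
        simp [hA', hab]
      have e2 : (univ.filter fun x : k => x ^ 2 - t * x + n = 0) = {a₀, b₀} := by
        ext x
        simp [hB]
      rw [e1, e2, card_empty, card_pair hab]
  · -- `α ∉ k`: then `β = α ^ q ≠ α`, the fibre is `{α, β}` and there are no roots in `k`
    have hαq : α ^ q = β := (hφ α (Or.inl rfl)).resolve_left hα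
    have hne : α ≠ β := fun h => hα (hαq.trans h.symm)
    have hβq : β ^ q = α := by rw [← hαq, pow_card_pow_card_of_finrank_eq_two h2]
    have hA' : ∀ z : l, (Algebra.trace k l z = t ∧ Algebra.norm k z = n) ↔ (z = α ∨ z = β) := by
      intro z
      rw [hA]
      refine ⟨fun h => hAroot z h.1 h.2, ?_⟩
      rintro (rfl | rfl)
      · rw [hαq]
        exact ⟨hs, hp⟩
      · rw [hβq, add_comm, mul_comm]
        exact ⟨hs, hp⟩
    have hB : ∀ x : k, ¬ (x ^ 2 - t * x + n = 0) := by
      intro x hx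
      have hx' : algebraMap k l x = α ∨ algebraMap k l x = β := by
        rw [← hroot]
        simpa using congr_arg (algebraMap k l) hx
      rcases hx' with h | h
      · exact hα (by rw [← h, hfix])
      · have hβ : β ^ q = β := by rw [← h, hfix]
        exact hne (hβq.symm.trans hβ)
    have e1 : (univ.filter fun z : l => Algebra.trace k l z = t ∧ Algebra.norm k z = n) =
        {α, β} := by
      ext z
      simp [hA']
    have e2 : (univ.filter fun x : k => x ^ 2 - t * x + n = 0) = ∅ := by
      ext x
      simp [hB]
    rw [e1, e2, card_pair hne, card_empty]

/-! ### Fibring the two character sums over the trace -/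

variable (l) in
/-- The norm-fibre sum grouped by the value of the trace:
`∑_{z ∈ l, N z = a} ψ(Tr z) = ∑_{t ∈ k} #{z ∈ l : Tr z = t ∧ N z = a} · ψ(t)`. [folklore] -/
theorem sum_filter_norm_addChar_trace_eq_sum_card_mul [DecidableEq k] (ψ : AddChar k ℂ) (a : k) :
    (∑ z ∈ univ.filter (fun z : l => Algebra.norm k z = a), ψ (Algebra.trace k l z)) =
      ∑ t : k, ((univ.filter fun z : l =>
        Algebra.trace k l z = t ∧ Algebra.norm k z = a).card : ℂ) * ψ t := by
  rw [← Finset.sum_fiberwise' (univ.filter fun z : l => Algebra.norm k z = a) (Algebra.trace k l)]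
  refine Finset.sum_congr rfl fun t _ => ?_
  rw [Finset.sum_const, nsmul_eq_mul, Finset.filter_filter]
  congr 3
  ext z
  simp only [mem_filter, mem_univ, true_and, and_comm]

/-- The Kloosterman sum grouped by the value of `x + a/x`: for `a ∈ kˣ`,
`∑_{x ∈ kˣ} ψ(x + a x⁻¹) = ∑_{t ∈ k} #{x ∈ k : x² - t x + a = 0} · ψ(t)`, since `x ↦ (x, a/x)` is a
bijection from `kˣ` onto the pairs with product `a`, and `x + a/x = t ↔ x² - tx + a = 0` for
`x ≠ 0` (while `x = 0` is never a root as `a ≠ 0`). [folklore] -/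
theorem sum_units_addChar_add_mul_inv_eq_sum_card_mul [DecidableEq k] (ψ : AddChar k ℂ) (a : kˣ) :
    (∑ x : kˣ, ψ (x + a * x⁻¹)) =
      ∑ t : k, ((univ.filter fun x : k => x ^ 2 - t * x + a = 0).card : ℂ) * ψ t := by
  rw [← Finset.sum_fiberwise' univ (fun x : kˣ => (x + a * x⁻¹ : k))]
  refine Finset.sum_congr rfl fun t _ => ?_
  rw [Finset.sum_const, nsmul_eq_mul]
  congr 2
  refine Finset.card_bij (fun x _ => (x : k)) (fun x hx => ?_) (fun x _ y _ h => Units.ext h)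
    (fun y hy => ?_)
  · simp only [mem_filter, mem_univ, true_and] at hx ⊢
    rw [← hx]
    linear_combination (-(a : k)) * Units.inv_mul x
  · simp only [mem_filter, mem_univ, true_and] at hy
    have hy0 : y ≠ 0 := by
      rintro rfl
      simp at hy
    refine ⟨Units.mk0 y hy0, ?_, rfl⟩
    simp only [mem_filter, mem_univ, true_and, Units.val_inv_eq_inv_val, Units.val_mk0]
    field_simp
    linear_combination hy

/-! ### The identity -/

variable (k l) in
/-- **Norm-fibre sum + Kloosterman sum = `2 ∑_t ψ(t)`** (any additive character `ψ`): for a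
quadratic extension `l/k` of finite fields and `a ∈ kˣ`,
`∑_{z ∈ l, N z = a} ψ(Tr z) + ∑_{x ∈ kˣ} ψ(x + a x⁻¹) = 2 ∑_{t ∈ k} ψ(t)`, by the point count
`#{Tr = t, N = a} + #{x² - tx + a = 0} = 2`. [folklore] -/
theorem sum_normFibre_addChar_trace_add_kloosterman [DecidableEq k] (h2 : Module.finrank k l = 2)
    (ψ : AddChar k ℂ) (a : kˣ) :
    (∑ z ∈ univ.filter (fun z : l => Algebra.norm k z = a), ψ (Algebra.trace k l z)) +
      ∑ x : kˣ, ψ (x + a * x⁻¹) = 2 * ∑ t : k, ψ t := by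
  rw [sum_filter_norm_addChar_trace_eq_sum_card_mul l ψ a,
    sum_units_addChar_add_mul_inv_eq_sum_card_mul ψ a, ← Finset.sum_add_distrib, Finset.mul_sum]
  refine Finset.sum_congr rfl fun t _ => ?_
  rw [← add_mul, ← Nat.cast_add, card_filter_trace_norm_add_card_filter_quadratic h2, Nat.cast_two]

variable (k l) in
/-- **Norm-fibre sum = − Kloosterman sum** (the residue-field identity behind the fundamental
lemma for the unit of the Hecke algebra in quadratic base change for `GL(2)`, Ye 1989; folklore
as a finite-field character-sum identity).  For a quadratic extension `l/k` of finite fields, a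
nontrivial additive character `ψ` of `k` and `a ∈ kˣ`,
`∑_{z ∈ l, N_{l/k} z = a} ψ(Tr_{l/k} z) = - ∑_{x ∈ kˣ} ψ(x + a x⁻¹)`. [folklore] -/
theorem sum_normFibre_addChar_trace_eq_neg_kloosterman [DecidableEq k]
    (h2 : Module.finrank k l = 2) (ψ : AddChar k ℂ) (hψ : ψ ≠ 1) (a : kˣ) :
    (∑ z ∈ univ.filter (fun z : l => Algebra.norm k z = a), ψ (Algebra.trace k l z)) =
      -∑ x : kˣ, ψ (x + a * x⁻¹) := by
  rw [eq_neg_iff_add_eq_zero, sum_normFibre_addChar_trace_add_kloosterman k l h2 ψ a,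
    AddChar.sum_eq_zero_of_ne_one hψ, mul_zero]

variable (k l) in
/-- **The fibres of the norm of a quadratic extension of finite fields have `q + 1` elements**:
for `a ∈ kˣ`, `#{z ∈ l : N_{l/k} z = a} = #k + 1` (the case `ψ = 1` of
`sum_normFibre_addChar_trace_add_kloosterman`: `#{N = a} + (q - 1) = 2q`). [folklore] -/
theorem card_filter_norm_eq_card_add_one [DecidableEq k] (h2 : Module.finrank k l = 2) (a : kˣ) :
    (univ.filter fun z : l => Algebra.norm k z = a).card = Fintype.card k + 1 := by
  have h := sum_normFibre_addChar_trace_add_kloosterman k l h2 (1 : AddChar k ℂ) a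
  simp only [AddChar.one_apply, Finset.sum_const, nsmul_eq_mul, mul_one, Finset.card_univ,
    Fintype.card_units] at h
  have hq : 1 ≤ Fintype.card k := Fintype.card_pos
  rw [Nat.cast_sub hq, Nat.cast_one] at h
  have h' : ((univ.filter fun z : l => Algebra.norm k z = a).card : ℂ) = Fintype.card k + 1 := by
    linear_combination h
  exact_mod_cast h'

end Literature.NumberTheory.GaussSums
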